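/-
Copyright: pub-hodgecm formalisation cell (harness21, 2026). New file (not vendored).
-/
import Summits.HodgeConjecture.HodgeCM.Geometry.Facts
import Summits.HodgeConjecture.HodgeCM.Prior.Perl34_5

/-!
# The automorphic–geometric bridge of PerL §§3–4 (interface, no axioms)

PerL v5 proves Thm 4.4 in three moves (follow-ups §B.1; `typing-check-perL.md`):
1. **spectral isolation** on `[U(W)]` for the seesaw plane `W = W₁ ⊕ W₂ ≅ W₃ ⊕ W₄` (Def 3.2): the closed
   spans `S₁₂, S₃₄ ⊂ L²([G_U])` of the theta functions `ϑ_{T,χ}(Φ)` attached to the allowed pairs of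
   type (12), resp. (34), COINCIDE (Prop 3.6, Thm 3.7) — machine-checked over the abstract interface
   `Perl34.IsolationSetting` (`HodgeCM.Prior.Perl34`: `C1_prop36`, `C2_thm37`; hypotheses `H_chars` =
   Lemma 4.2(b) and `H_occ` = Lemma 4.1(c), themselves discharged by `C4.H_chars`, `C4a.H_occ`);
2. **non-vanishing** `S₁₂ ≠ 0` (Prop 4.3): nonzero theta one-forms of types `Ψ₀`, `Ψ₁` exist (Lemma
   4.2(a), Rallis' inner product formula) and some such pair has a wedge that is not identically zero
   (the line-field argument on the surface); that wedge lies in `S₁₂` (Lemma 3.5, seesaw direction);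
3. **realisation**: the generators of `S₃₄` are, at a deep enough torsion-free congruence level `Γ`,
   finite sums of the `L²`-functions of wedges of theta one-forms of types `Ψ₂`, `Ψ₃` (Lemma 3.5 +
   Matsushima/Borel–Wallach), theta one-forms of type `Ψ` are `B_Ψ`-isotypic `σ`-eigen holomorphic
   one-forms `F^*α` on `P_Γ` ([Y1neg] v2 Thm 8.1(a), Prop 6.2), and the `L²` pairing of two
   wedge-functions is a nonzero multiple of the period `∫ ω₁∧ω₂∧\overline{ω₃∧ω₄}`.

This file records moves 2–3 as a STRUCTURE `ThetaRealisation` whose fields are exactly the objects and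
identities the final step of Thm 4.4 consumes; Prop 4.3 (`S₁₂ ≠ ⊥`) is then PROVED over the interface
(`HodgeCM.StubTree.prop43`). EXISTENCE of the structure for the PerL data and for the transposed data
of rfwf Thm 4.1 is the content of the stubs `realisation_exists_perL` / `realisation_exists_face`
(`HodgeCM.StubTree.PerLProof`) — one existential package each, never a universally quantified lower
layer (a layer "for every family of theta forms …" would be satisfied by `Theta i Γ := U_Ψᵢ(Γ)` and then
over-claim: PerL v1's refuted "wedge from an unconstrained family"). Nothing here is asserted.

Revision note (referee 2, G1): gen 1 of this file had `real12/real34` (generator ↦ ONE wedge of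
arbitrary `U_Ψ`-forms) and no field relating `U_Ψ`-forms back to `S₁₂`, so `prop43` was not closable
over the interface. Gen 2 names the theta one-forms (`Theta`, typed by `Theta_sub`), records Lemma 3.5 in
BOTH directions restricted to theta forms (`gen12`: wedges of theta forms of the allowed pair (12) lie in
`S₁₂`; `real34`: generators of `S₃₄` lie in the closed span of wedges of theta forms of the pair (34)), and
records Prop 4.3 as `lineField`.  Gen 7 (referee A round 10, statement audit against the landed PerL v5 tex):
`lineField` weakened from a per-level `∀ Γ` form to Prop 4.3's `∃`, `real34` from "finite sum at one level" to
Lemma 3.5's closure, `supply` (Lemma 4.2(a)) turned from a field into a theorem derived from `lineField`.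
-/

noncomputable section

open scoped TensorProduct InnerProductSpace

namespace HodgeCM

open Literature.AlgebraicGeometry.Motives (CMType HodgeStructure)
open Literature.AlgebraicGeometry.Motives.HodgeStructure (EndAction conj)
open HodgeCM.Prior.Perl34File

namespace Universe

variable (U : Universe)

/-- `H^{1,0}(X) ⊂ H¹(X, ℂ)`. -/
def H10 (X : U.Var) : Submodule ℂ (U.CohC X 1) := (U.hodge X 1).piece 1 0

/-- **Theta realisation data** for: a surface field `L` with `ι₁`, `(V₃,h)`; one-form field `K` with four
types `Ψ i` and eigen-embedding `σ` (PerL: `K` sextic, `L = K̃`, `σ = φ₁`; rfwf Thm 4.1: `K = L = F`,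
`σ = ι₁`). Fields:
* `S` — the isolation setting of PerL §3.3 for the seesaw plane attached to `(Ψ, V₃)` (Def 3.2, Lemma 3.3),
  WITH its hypotheses `H_chars` (Lemma 4.2(b)) and `H_occ` (Lemma 4.1(c));
* `Λ Γ ω ω′` — the wedge `ω ∧ ω′` of two classes in `H¹(P_Γ, ℂ)` as an element of `L²([G_U])`
  (holomorphic 2-forms are square-integrable automorphic forms: Matsushima–Murakami, Borel–Wallach VII);
* `Theta i Γ` — the THETA ONE-FORMS of type `Ψᵢ` at level `Γ`: the holomorphic one-forms on `P_Γ` given by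
  the theta lifts `θ_φ(χ′)` from the FIXED hermitian line `W_i` of Def 3.2 with `(W_i, μ_i, χ′)` allowed
  (PerL tex ll. 269–279, 340–349); `Theta_sub` — [Y1neg] v2 Thm 8.1(a) / Prop 6.2: a theta one-form of
  type `Ψ` is `B_Ψ`-isotypic and `σ`-eigen, i.e. lies in `U_Ψ(Γ)` (`Universe.Uiso`);
* `lineField` — **Prop 4.3** (`prop:S12`, PerL v5 = blob d912a121, `HOME/inputs/2001/…pmqp-galois-closure…
  paper.tex` ll. 639–684), in its printed EXISTENTIAL form since gen 7 (referee A round 10, E1): at SOME level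
  there are theta one-forms `ω₁ ∈ Theta 0 Γ`, `ω₂ ∈ Theta 1 Γ` with `ω₁ ∧ ω₂ ≢ 0`.  PerL's proof: the spans
  `𝒰_i` of the one-forms `u_f` over ALL automorphic `χ′_i` and all Fock–Schwartz `φ` (every level at once) are
  `G_U(L₀)`-stable and nonzero (Lemma 4.2); if all wedges vanished, the evaluation images of `𝒰₂` would form a
  line field `ℓ` invariant under the image `Δ` of `G_U(L₀)`, dense in `U(2,1)` by real approximation (San
  Cor. 3.5(iii), PR Thm. 7.7), forcing a `K_{x₀} ≅ U(2)×U(1)`-invariant line in `T*_{x₀}𝔹² ≅ ℂ²` — impossible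
  since `SU(2)` is transitive on lines.  This is the one place where v1's error ("wedge from an unconstrained
  family") was repaired in v2.  WHY IT MIGHT FAIL: only through the identification of PerL's `u_f` with classes in
  `H¹(P_Γ, ℂ)` at a torsion-free level (Matsushima–Murakami) — the group-theoretic core is as printed.  Gens 2–6
  carried a PER-LEVEL strengthening (`∀ Γ`, nonzero forms of both types at `Γ` ⇒ a nonzero wedge at `Γ`) that
  PerL does not prove (at a fixed level only the discrete `Γ` acts; no density); it was weakened to the print
  form before any prover built against it.  **Lemma 4.2(a)** (`supply`: nonzero theta one-forms of types `Ψ₀`,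
  `Ψ₁` at a common level; Rallis, `Prior.Perl34.C4.θvec_ne_zero`) is since gen 7 the DERIVED theorem
  `ThetaRealisation.supply` (a nonzero wedge has nonzero factors), no longer a field;
* `gen12` — **Lemma 3.5, seesaw direction, pair (12)**: the wedge of theta one-forms of types `Ψ₀`, `Ψ₁`,
  as an `L²` function on `[G_U]`, lies in `S₁₂` (it IS a generator `ϑ_{T,χ₁χ₂}(Φ₁ ⊗ Φ₂)` by the seesaw
  identity; Kudla splitting, HKS);
* `real34` — **Lemma 3.5, generation direction, pair (34)** (`lem:S12`, PerL v5 tex ll. 350–353), in its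
  printed CLOSURE form since gen 7 (referee A round 10, E2): every generator `ϑ_{T′,χ}(Φ)` of `S₃₄` (`χ` allowed
  of type (34), `Φ ∈ 𝒮^κ`) lies in the topological closure of the span of ALL wedge-functions `Λ Γ ω₃ ω₄`
  (`Γ` any level, `ω₃ ∈ Theta 2 Γ`, `ω₄ ∈ Theta 3 Γ`).  Gens 2–6 asked for a FINITE sum at one level — true for
  Fock-polynomial `Φ` (the seesaw identity) but for general Schwartz `Φ` Lemma 3.5 only gives the closure ("by
  continuity"); the consumer `thm44_of_realisation` never needed more than the closure;
* `cover`, `Λ_cover`, `level_inf` — change of level (pullback along `P_{Γ′} → P_Γ` for `Γ′ ≤ Γ`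
  preserves the wedge-function; two levels have a common refinement);
* `inner_Λ` — Petersson = period: `⟪Λ ω₃ ω₄, Λ ω₁ ω₂⟫ = c_Γ · ∫ ω₁∧ω₂∧\overline{ω₃∧ω₄}` on `(1,0)`-classes,
  `c_Γ ≠ 0` (Mathlib's inner product is conjugate-linear in the first slot).
The symmetric statements (`gen34`, `real12`, supply of types `Ψ₂`, `Ψ₃`) hold equally in the intended
model but are NOT consumed by the proof of Thm 4.4 (`S₁₂ ∋` a nonzero wedge; `S₁₂ = S₃₄` by Thm 3.7;
`S₃₄` is generated by (34)-wedges), so they are not fields. -/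
structure ThetaRealisation {L : CMField} (ι₁ : L →+* ℂ) (V : HermSpace3 L ι₁)
    (K : CMField) (Ψ : Fin 4 → CMType K) (σ : K →+* ℂ) where
  /-- `L²([U(W)])` -/
  H : Type
  /-- `L²([G_U])` -/
  HG : Type
  /-- `C([G_U])` with the sup norm -/
  CG : Type
  /-- `U(W)(𝔸)` -/
  G : Type
  /-- the `κ`-typed Schwartz space `𝒮^κ` -/
  SK : Type
  /-- index types of the isotypic decompositions -/
  SigIdx : Type
  SigIdxG : Type
  [i1 : NormedAddCommGroup H] [i2 : InnerProductSpace ℂ H] [i3 : CompleteSpace H]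
  [i4 : NormedAddCommGroup HG] [i5 : InnerProductSpace ℂ HG] [i6 : CompleteSpace HG]
  [i7 : NormedAddCommGroup CG] [i8 : NormedSpace ℂ CG]
  [i9 : Group G] [i10 : TopologicalSpace G] [i11 : TopologicalSpace SK]
  /-- the isolation setting (PerL §3.3) incl. `H_chars` (L4.2(b)) and `H_occ` (L4.1(c)) -/
  S : Perl34.IsolationSetting H HG CG G SK SigIdx SigIdxG
  /-- wedge of two degree-one classes of `P_Γ` as an `L²` function on `[G_U]` -/
  Λ : ∀ Γ : Level V, U.CohC (U.pms L ι₁ V Γ) 1 →ₗ[ℂ] U.CohC (U.pms L ι₁ V Γ) 1 →ₗ[ℂ] HG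
  /-- the theta one-forms of type `Ψ i` at level `Γ` (from the fixed allowed line data of Def 3.2) -/
  Theta : Fin 4 → ∀ Γ : Level V, Set (U.CohC (U.pms L ι₁ V Γ) 1)
  /-- [Y1neg] v2 Thm 8.1(a): theta one-forms of type `Ψ` are `B_Ψ`-isotypic `σ`-eigen holomorphic forms -/
  Theta_sub : ∀ (i : Fin 4) (Γ : Level V), Theta i Γ ⊆ U.Uiso Γ K (Ψ i) σ
  /-- **Prop 4.3** (`prop:S12`, PerL v5 tex ll. 639–684), EXISTENTIAL form (gen 7, referee A round 10 E1): at SOME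
  level there are theta one-forms of types `(Ψ₀, Ψ₁)` whose wedge is not identically zero.  (Gens 2–6 carried the
  stronger per-level form `∀ Γ, (nonzero forms of both types at Γ) → ∃ such a pair at Γ`, which PerL does not prove:
  its density argument uses all levels at once.  Lemma 4.2(a)'s `supply` is now the derived theorem
  `ThetaRealisation.supply`.) -/
  lineField : ∃ Γ : Level V, ∃ ω₁ ∈ Theta 0 Γ, ∃ ω₂ ∈ Theta 1 Γ, Λ Γ ω₁ ω₂ ≠ 0
  /-- Lemma 3.5, seesaw direction (12): wedges of theta one-forms of the allowed pair lie in `S₁₂` -/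
  gen12 : ∀ (Γ : Level V) (ω₁ ω₂ : U.CohC (U.pms L ι₁ V Γ) 1),
    ω₁ ∈ Theta 0 Γ → ω₂ ∈ Theta 1 Γ → Λ Γ ω₁ ω₂ ∈ S.t12.S12
  /-- **Lemma 3.5** (`lem:S12`, PerL v5 tex ll. 350–353), generation direction (34), CLOSURE form (gen 7,
  referee A round 10 E2): every generator `ϑ_{T′,χ}(Φ)` of `S₃₄` (`χ` allowed of type (34), `Φ ∈ 𝒮^κ`) lies in the
  topological closure of the span of the wedge-functions of theta one-forms of types `(Ψ₂, Ψ₃)`, over all levels.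
  (Gens 2–6 asked for a FINITE sum at one level, which is Lemma 3.5's identity for Fock-polynomial `Φ` only; for
  general Schwartz `Φ` the lemma gives the closure, "by continuity".) -/
  real34 : ∀ χ : S.t34.X, S.t34.allowed χ → ∀ Φ : SK,
    S.t34.ϑ χ Φ ∈ (Submodule.span ℂ
      {x : HG | ∃ Γ : Level V, ∃ ω₃ ∈ Theta 2 Γ, ∃ ω₄ ∈ Theta 3 Γ, x = Λ Γ ω₃ ω₄}).topologicalClosure
  /-- the covering `P_{Γ′} → P_Γ` for `Γ′ ≤ Γ` -/
  cover : ∀ Γ Γ' : Level V, Γ'.Γ ≤ Γ.Γ → U.Mor (U.pms L ι₁ V Γ') (U.pms L ι₁ V Γ)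
  /-- the wedge-function is level-independent -/
  Λ_cover : ∀ (Γ Γ' : Level V) (h : Γ'.Γ ≤ Γ.Γ) (ω ω' : U.CohC (U.pms L ι₁ V Γ) 1),
    Λ Γ' (U.pullC (cover Γ Γ' h) 1 ω) (U.pullC (cover Γ Γ' h) 1 ω') = Λ Γ ω ω'
  /-- two torsion-free congruence levels have a common torsion-free congruence refinement -/
  level_inf : ∀ Γ₁ Γ₂ : Level V, ∃ Γ : Level V, Γ.Γ ≤ Γ₁.Γ ∧ Γ.Γ ≤ Γ₂.Γ
  /-- Petersson pairing of wedge-functions = the period, up to a nonzero constant, on `(1,0)`-classes -/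
  inner_Λ : ∀ Γ : Level V, ∃ c : ℂ, c ≠ 0 ∧ ∀ ω : Fin 4 → U.CohC (U.pms L ι₁ V Γ) 1,
    (∀ i, ω i ∈ U.H10 (U.pms L ι₁ V Γ)) →
      ⟪Λ Γ (ω 2) (ω 3), Λ Γ (ω 0) (ω 1)⟫_ℂ = c * U.period (U.pms L ι₁ V Γ) ω

attribute [instance] ThetaRealisation.i1 ThetaRealisation.i2 ThetaRealisation.i3 ThetaRealisation.i4
  ThetaRealisation.i5 ThetaRealisation.i6 ThetaRealisation.i7 ThetaRealisation.i8 ThetaRealisation.i9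
  ThetaRealisation.i10 ThetaRealisation.i11

/-- **Lemma 4.2(a)** in the shape gens 2–6 carried as the FIELD `supply` (Rallis inner product formula,
`Prior.Perl34.C4.θvec_ne_zero`): nonzero theta one-forms of types `Ψ₀` and `Ψ₁` exist at a common level — since
gen 7 DERIVED from `lineField` (a nonzero wedge has nonzero factors, `Λ Γ` being bilinear), so it is no longer a
proof obligation of the open inputs `RealisationExistsPerL/Face`. -/
theorem ThetaRealisation.supply {L : CMField} {ι₁ : L →+* ℂ} {V : HermSpace3 L ι₁} {K : CMField}
    {Ψ : Fin 4 → CMType K} {σ : K →+* ℂ} (R : U.ThetaRealisation ι₁ V K Ψ σ) :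
    ∃ Γ : Level V, (∃ ω₁ ∈ R.Theta 0 Γ, ω₁ ≠ 0) ∧ (∃ ω₂ ∈ R.Theta 1 Γ, ω₂ ≠ 0) := by
  obtain ⟨Γ, ω₁, h₁, ω₂, h₂, hne⟩ := R.lineField
  refine ⟨Γ, ⟨ω₁, h₁, ?_⟩, ⟨ω₂, h₂, ?_⟩⟩
  · rintro rfl
    exact hne (by rw [map_zero, LinearMap.zero_apply])
  · rintro rfl
    exact hne (by rw [map_zero])

/-! ### The period as a function of four arguments; (semi)linearity in each slot -/

/-- `∫ a ∧ b ∧ \overline{c ∧ d}` as a function of four separate classes (`U.period X ω` is by definition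
`U.period4 X (ω 0) (ω 1) (ω 2) (ω 3)`). -/
def period4 (X : U.Var) (a b c d : U.CohC X 1) : ℂ := U.trC X 4 (U.quadC X a b (conj c) (conj d))

/-- (Ported verbatim from the HodgeCMPerL package; no docstring in the source.) -/
theorem period_eq_period4 (X : U.Var) (ω : Fin 4 → U.CohC X 1) :
    U.period X ω = U.period4 X (ω 0) (ω 1) (ω 2) (ω 3) := rfl

section period4

variable (X : U.Var) (a a' b b' c c' d d' : U.CohC X 1) (r : ℂ)

/-- (Ported verbatim from the HodgeCMPerL package; no docstring in the source.) -/
theorem period4_add₀ : U.period4 X (a + a') b c d = U.period4 X a b c d + U.period4 X a' b c d := by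
  simp only [period4, Universe.quadC, map_add, LinearMap.add_apply]

/-- (Ported verbatim from the HodgeCMPerL package; no docstring in the source.) -/
theorem period4_add₁ : U.period4 X a (b + b') c d = U.period4 X a b c d + U.period4 X a b' c d := by
  simp only [period4, Universe.quadC, map_add, LinearMap.add_apply]

/-- (Ported verbatim from the HodgeCMPerL package; no docstring in the source.) -/
theorem period4_add₂ : U.period4 X a b (c + c') d = U.period4 X a b c d + U.period4 X a b c' d := by
  simp only [period4, Universe.quadC, map_add, LinearMap.add_apply]

/-- (Ported verbatim from the HodgeCMPerL package; no docstring in the source.) -/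
theorem period4_add₃ : U.period4 X a b c (d + d') = U.period4 X a b c d + U.period4 X a b c d' := by
  simp only [period4, Universe.quadC, map_add]

/-- (Ported verbatim from the HodgeCMPerL package; no docstring in the source.) -/
theorem period4_smul₀ : U.period4 X (r • a) b c d = r * U.period4 X a b c d := by
  simp only [period4, Universe.quadC, map_smul, LinearMap.smul_apply, smul_eq_mul]

/-- (Ported verbatim from the HodgeCMPerL package; no docstring in the source.) -/
theorem period4_smul₁ : U.period4 X a (r • b) c d = r * U.period4 X a b c d := by
  simp only [period4, Universe.quadC, map_smul, LinearMap.smul_apply, smul_eq_mul]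

/-- (Ported verbatim from the HodgeCMPerL package; no docstring in the source.) -/
theorem period4_smul₂ : U.period4 X a b (r • c) d = starRingEnd ℂ r * U.period4 X a b c d := by
  simp only [period4, Universe.quadC, HodgeStructure.conj_smul, map_smul, LinearMap.smul_apply,
    smul_eq_mul]

/-- (Ported verbatim from the HodgeCMPerL package; no docstring in the source.) -/
theorem period4_smul₃ : U.period4 X a b c (r • d) = starRingEnd ℂ r * U.period4 X a b c d := by
  simp only [period4, Universe.quadC, HodgeStructure.conj_smul, map_smul, smul_eq_mul]

end period4

/-- Expansion step: a functional that is additive and semilinear in its argument and nonzero at some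
element of a span is nonzero at some generator. -/
theorem exists_mem_ne_zero_of_span {M : Type*} [AddCommGroup M] [Module ℂ M] {φ : M → ℂ}
    (hadd : ∀ x y, φ (x + y) = φ x + φ y) (hsmul : ∀ (c : ℂ) (x : M), ∃ d : ℂ, φ (c • x) = d * φ x)
    {s : Set M} {ω : M} (hω : ω ∈ Submodule.span ℂ s) (hne : φ ω ≠ 0) : ∃ x ∈ s, φ x ≠ 0 := by
  by_contra h
  simp only [not_exists, not_and, not_not] at h
  have key : ∀ ω ∈ Submodule.span ℂ s, φ ω = 0 := by
    intro ω hω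
    induction hω using Submodule.span_induction with
    | mem x hx => exact h x hx
    | zero =>
      have h0 := hadd 0 0
      rw [add_zero] at h0
      simpa using h0
    | add x y _ _ hx hy => rw [hadd, hx, hy, add_zero]
    | smul c x _ hx =>
      obtain ⟨d, hd⟩ := hsmul c x
      rw [hd, hx, mul_zero]
  exact hne (key ω hω)

/-! ### Interface lemmas used by Thm 4.4 (proved from `Fact_pull_hodge`, `Fact_pull_comp`) -/

variable {U}

/-- Pullback preserves every Hodge piece `H^{p,q}` on the line `p + q = k` (from `Fact_pull_hodge` and
`conj ∘ f^*_ℂ = f^*_ℂ ∘ conj`). -/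
theorem pullC_mem_piece (hH : U.Fact_pull_hodge) {X Y : U.Var} (f : U.Mor X Y) (k : ℕ) {p q : ℤ}
    (hpq : p + q = (k : ℤ)) {x : U.CohC Y k} (hx : x ∈ (U.hodge Y k).piece p q) :
    U.pullC f k x ∈ (U.hodge X k).piece p q := by
  rw [HodgeStructure.mem_piece_iff _ hpq] at hx ⊢
  refine ⟨hH X Y f k p (Submodule.mem_map_of_mem hx.1), ?_⟩
  have hc : conj (U.pullC f k x) = U.pullC f k (conj x) := by
    unfold Universe.pullC
    exact HodgeStructure.conj_baseChange _ _
  rw [hc]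
  exact hH X Y f k q (Submodule.mem_map_of_mem hx.2)

/-- Pullback preserves `H^{1,0}`. -/
theorem pullC_mem_H10 (hH : U.Fact_pull_hodge) {X Y : U.Var} (f : U.Mor X Y) {x : U.CohC Y 1}
    (hx : x ∈ U.H10 Y) : U.pullC f 1 x ∈ U.H10 X :=
  pullC_mem_piece hH f 1 (by norm_num) hx

/-- `U_Ψ(Γ) ⊆ H^{1,0}(P_Γ)`: isotypic holomorphic one-forms are holomorphic (`alphaLine ≤ piece 1 0`
by `eigenPiece_le_piece`, then `pullC_mem_H10`). -/
theorem Uiso_le_H10 (hH : U.Fact_pull_hodge) {L : CMField} {ι₁ : L →+* ℂ} {V : HermSpace3 L ι₁}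
    (Γ : Level V) (K : CMField) (Ψ : CMType K) (σ : K →+* ℂ) :
    U.Uiso Γ K Ψ σ ≤ U.H10 (U.pms L ι₁ V Γ) := by
  refine Submodule.span_le.mpr ?_
  rintro ω ⟨F, α, hα, rfl⟩
  exact pullC_mem_H10 hH F (HodgeStructure.EndAction.eigenPiece_le_piece _ _ _ _ hα)

/-- `U_Ψ` is stable under pullback along any morphism of surfaces of the tower (`(F ∘ g)^* = g^* F^*`). -/
theorem pullC_mem_Uiso (hc : U.Fact_pull_comp) {L : CMField} {ι₁ : L →+* ℂ} {V : HermSpace3 L ι₁}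
    {Γ Γ' : Level V} (g : U.Mor (U.pms L ι₁ V Γ') (U.pms L ι₁ V Γ)) (K : CMField) (Ψ : CMType K)
    (σ : K →+* ℂ) {ω : U.CohC (U.pms L ι₁ V Γ) 1} (hω : ω ∈ U.Uiso Γ K Ψ σ) :
    U.pullC g 1 ω ∈ U.Uiso Γ' K Ψ σ := by
  unfold Universe.Uiso at hω ⊢
  refine Submodule.span_induction (p := fun x _ => U.pullC g 1 x ∈ _) ?_ ?_ ?_ ?_ hω
  · rintro x ⟨F, α, hα, rfl⟩
    refine Submodule.subset_span ⟨U.comp g F, α, hα, ?_⟩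
    unfold Universe.pullC
    rw [hc _ _ _ g F 1, LinearMap.baseChange_comp]
    rfl
  · simp
  · intro x y _ _ hx hy
    rw [map_add]
    exact Submodule.add_mem _ hx hy
  · intro c x _ hx
    rw [map_smul]
    exact Submodule.smul_mem _ c hx

/-- **Multilinear expansion** (last step of PerL Thm 4.4): if four classes `ωᵢ ∈ U_{Ψᵢ}(Γ)` (finite sums
of pure pullbacks `F^*α`) have nonzero period, some tuple of PURE pullbacks has nonzero period, which is
`PeriodNV` verbatim. -/
theorem periodNV_of_period_ne_zero {L : CMField} {ι₁ : L →+* ℂ} {V : HermSpace3 L ι₁} {K : CMField}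
    {Ψ : Fin 4 → CMType K} {σ : K →+* ℂ} (Γ : Level V) (ω : Fin 4 → U.CohC (U.pms L ι₁ V Γ) 1)
    (hU : ∀ i, ω i ∈ U.Uiso Γ K (Ψ i) σ) (hper : U.period (U.pms L ι₁ V Γ) ω ≠ 0) :
    U.PeriodNV ι₁ V K Ψ σ := by
  have hU' : ∀ i, ω i ∈ Submodule.span ℂ {x : U.CohC (U.pms L ι₁ V Γ) 1 |
      ∃ (F : U.Mor (U.pms L ι₁ V Γ) (U.cmAV K (Ψ i))) (α : U.CohC (U.cmAV K (Ψ i)) 1),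
        α ∈ U.alphaLine K (Ψ i) σ ∧ x = U.pullC F 1 α} := hU
  rw [period_eq_period4] at hper
  -- slot 0
  obtain ⟨a, ha, h0⟩ := exists_mem_ne_zero_of_span (φ := fun x => U.period4 _ x (ω 1) (ω 2) (ω 3))
    (fun x y => U.period4_add₀ _ x y _ _ _) (fun r x => ⟨r, U.period4_smul₀ _ x _ _ _ r⟩) (hU' 0) hper
  -- slot 1
  obtain ⟨b, hb, h1⟩ := exists_mem_ne_zero_of_span (φ := fun x => U.period4 _ a x (ω 2) (ω 3))
    (fun x y => U.period4_add₁ _ a x y _ _) (fun r x => ⟨r, U.period4_smul₁ _ a x _ _ r⟩) (hU' 1) h0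
  -- slot 2
  obtain ⟨c, hc, h2⟩ := exists_mem_ne_zero_of_span (φ := fun x => U.period4 _ a b x (ω 3))
    (fun x y => U.period4_add₂ _ a b x y _) (fun r x => ⟨starRingEnd ℂ r, U.period4_smul₂ _ a b x _ r⟩)
    (hU' 2) h1
  -- slot 3
  obtain ⟨d, hd, h3⟩ := exists_mem_ne_zero_of_span (φ := fun x => U.period4 _ a b c x)
    (fun x y => U.period4_add₃ _ a b c x y) (fun r x => ⟨starRingEnd ℂ r, U.period4_smul₃ _ a b c x r⟩)
    (hU' 3) h2
  -- assemble the pure tuple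
  let ω' : Fin 4 → U.CohC (U.pms L ι₁ V Γ) 1 := fun i => match i with | 0 => a | 1 => b | 2 => c | 3 => d
  have hP : ∀ i, ∃ (F : U.Mor (U.pms L ι₁ V Γ) (U.cmAV K (Ψ i))) (α : U.CohC (U.cmAV K (Ψ i)) 1),
      α ∈ U.alphaLine K (Ψ i) σ ∧ ω' i = U.pullC F 1 α := by
    intro i
    match i with
    | 0 => exact ha
    | 1 => exact hb
    | 2 => exact hc
    | 3 => exact hd
  choose F α hα hω' using hP
  refine ⟨Γ, F, α, hα, ?_⟩
  have e : (fun i => U.pullC (F i) 1 (α i)) = ω' := funext fun i => (hω' i).symm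
  rw [e]
  exact h3

end Universe


end HodgeCM

end
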